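import Summits.SmoothPoincare4.SmoothPoincare4.Theorems.DottedCircleRasmussenDcrGapHelperFriendsCarrierTkAux15
import Summits.SmoothPoincare4.SmoothPoincare4.Theorems.DottedCircleRasmussenDcrGapHelperFriendsCarrierTkAux16
import Literature.Topology.FourManifolds.MMSWRasmussenFacts
import Literature.Topology.FourManifolds.MMSWFibreRotation
import Literature.Topology.FourManifolds.DehnSurgery
import Literature.Topology.FourManifolds.KirbyMoves
import Summits.SmoothPoincare4.SmoothPoincare4.Theses.DottedCircleRasmussen

/-!
# Helper `helper_friendsCarrier_Tk` (T_k: relative open trace of the model dotted handlebody with Y-collared end) of line `mk_friends` (skeleton v5) for crux `DcrGap`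
(item stmt-SmoothPoincare4-16128, route route-SmoothPoincare4-DottedCircleRasmussen)

**The registered helper stub `helper_friendsCarrier_Tk` of stub A (`stub_friendsCarrier`), proved.**  For a
model knot `K₀ ⊂ M_k = ∂D_k` with a tube `ν : 𝕊¹ × ℝ² → M_k` and a smooth `3`-manifold `Y` presented as
`M_k` surgered along `K₀` via `ν` (`jM` on `M_k ∖ K₀` with smooth inverse `ψ`, the new solid torus `jB`,
dual knot `μ₀` = core of `jB`), there is a Hausdorff `C^∞` `4`-manifold `T` — the relative open trace
`FriendsTk.TraceDatum.Trace` of `D_k` with a `2`-handle along `K₀` (`…TkAux3–6`, the `k ≥ 1` analogue of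
the tree's `OpenTrace.lean`, radial coordinate ↦ collar clock `…TkAux1`, tube coordinates `…TkAux2`, built
from the fibre-shrunken tube `…TkAux7`) — with a germ chart `i` along `D_k`, the core disc `f₀` of the
handle and its collar germ `g₀` (GERM and CORE-DISC clauses, `…TkAux5`), and the END COLLAR
`c : Y × ℝ ≅ T ∖ (i(D_k) ∪ f₀(𝔻²))` (`…TkAux8–16`, the port of the tree's `OpenTraceCollar.lean`): smooth
with smooth inverse, proper towards the core, closed towards the end; and the dual knot pushed in along
the collar bounds the cocore disc `inr({0} × D²)`, hence is null-homotopic in `T`.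

* `FriendsTk.EndDatum.SmoothPresentation.homotopic_const_of_core` — the null-homotopy of the pushed dual
  knot (contracting radially in the cocore plane);
* `helper_friendsCarrier_Tk` — the registered statement.

Everything is proved; no named facts, no `sorry`.
References: Kirby, *The Topology of 4-Manifolds* (1989), Ch. I §2, §5 [Kirby1989]; Gompf–Stipsicz (1999),
§5.3; Manolescu–Piccirillo (2023), §3.2 [ManolescuPiccirillo2023]; the tree's `OpenTrace.lean`,
`OpenTraceCollar.lean`, `TraceCollarProfile.lean` (`k = 0`).
-/

-- the prescribed namespace `Summit.<P>.<Sub>.…` duplicates `SmoothPoincare4` (P = Sub)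
set_option linter.dupNamespace false
set_option linter.style.longLine false

noncomputable section

open scoped Manifold ContDiff Topology
open Function Set Metric TopologicalSpace
open Literature.Topology.FourManifolds Literature.Topology.FourManifolds.MMSW
open Literature.AlgebraicTopology.Homotopy.HopfFibration

namespace Summit.SmoothPoincare4.SmoothPoincare4.Theorems.DcrGap.MkFriends

namespace FriendsTk

namespace EndDatum

namespace SmoothPresentation

variable {k : ℕ} {E : EndDatum k} {Y : Type*} [TopologicalSpace Y] [ChartedSpace (EuclideanSpace ℝ (Fin 3)) Y] (P : E.SmoothPresentation Y)

/-- **The pushed dual knot bounds the cocore**: a loop `L₀` in the trace equal to the collar at height `0`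
over the core circle `jB({0} × 𝕊¹)` of the surgery solid torus is `v ↦ inr (0, univBall⁻¹ (r₀ • v))`,
`r₀ = 2e^{-ψinv 1} < 2`, a circle in the cocore plane `inr({0} × ℝ²)`, which contracts radially to the
cocore centre `inr (0, 0)`. [cite: Kirby1989, Ch. I §2] -/
theorem homotopic_const_of_core (L₀ : C((Metric.sphere (0 : EuclideanSpace ℝ (Fin 2)) 1), E.Trace))
    (hL : ∀ v : Metric.sphere (0 : EuclideanSpace ℝ (Fin 2)) 1, ∀ h : ((0 : EuclideanSpace ℝ (Fin 2)), v) ∈ solidTorus,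
      L₀ v = E.collar P.jM P.jB P.ψ (P.jB ⟨((0 : EuclideanSpace ℝ (Fin 2)), v), h⟩, 0)) :
    ∃ x₀ : E.Trace, L₀.Homotopic (ContinuousMap.const (Metric.sphere (0 : EuclideanSpace ℝ (Fin 2)) 1) x₀) := by
  set κ := OpenPartialHomeomorph.univBall (0 : EuclideanSpace ℝ (Fin 2)) 2 with hκ
  set r₀ : ℝ := 2 * Real.exp (-TraceCollar.ψinv (Real.exp (-(0 : ℝ)))) with hr₀
  have hr₀pos : 0 < r₀ := by positivity
  have hr₀2 : r₀ < 2 := by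
    have hY : 0 < TraceCollar.ψinv (Real.exp (-(0 : ℝ))) := TraceCollar.ψinv_pos _
    have : Real.exp (-TraceCollar.ψinv (Real.exp (-(0 : ℝ)))) < 1 := Real.exp_lt_one_iff.2 (by linarith)
    simp only [hr₀]; linarith
  have hsolid : ∀ v : Metric.sphere (0 : EuclideanSpace ℝ (Fin 2)) 1, ((0 : EuclideanSpace ℝ (Fin 2)), v) ∈ solidTorus := fun v => by
    simp [mem_solidTorus_iff]
  -- the radial contraction in the cocore plane
  set F : unitInterval × (Metric.sphere (0 : EuclideanSpace ℝ (Fin 2)) 1) → EuclideanSpace ℝ (Fin 2) :=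
    fun p => ((1 - (p.1 : ℝ)) * r₀) • (p.2 : EuclideanSpace ℝ (Fin 2)) with hF
  have hFc : Continuous F := by
    simp only [hF]
    exact ((continuous_const.sub (continuous_subtype_val.comp continuous_fst)).mul continuous_const).smul
      (continuous_subtype_val.comp continuous_snd)
  have hFmem : ∀ p, F p ∈ Metric.ball (0 : EuclideanSpace ℝ (Fin 2)) 2 := by
    rintro ⟨t, v⟩
    have ht0 : 0 ≤ 1 - (t : ℝ) := sub_nonneg.2 t.2.2
    have ht1 : 1 - (t : ℝ) ≤ 1 := by linarith [t.2.1]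
    rw [Metric.mem_ball, dist_zero_right, hF]
    simp only
    rw [norm_smul_coe_sphere (mul_nonneg ht0 hr₀pos.le)]
    calc (1 - (t : ℝ)) * r₀ ≤ 1 * r₀ := by gcongr
      _ < 2 := by linarith
  have hH : Continuous fun p : unitInterval × (Metric.sphere (0 : EuclideanSpace ℝ (Fin 2)) 1) =>
      E.trGlueData.inr ((0 : EuclideanSpace ℝ (Fin 2)), κ.symm (F p)) := by
    have h1 : Continuous fun p : unitInterval × (Metric.sphere (0 : EuclideanSpace ℝ (Fin 2)) 1) => κ.symm (F p) :=
      (OpenPartialHomeomorph.continuousOn_univBall_symm (0 : EuclideanSpace ℝ (Fin 2)) 2).comp_continuous hFc hFmem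
    exact E.trGlueData.continuous_inr.comp (continuous_const.prodMk h1)
  refine ⟨E.trGlueData.inr ((0 : EuclideanSpace ℝ (Fin 2)), (0 : EuclideanSpace ℝ (Fin 2))), ⟨{
    toFun := fun p => E.trGlueData.inr ((0 : EuclideanSpace ℝ (Fin 2)), κ.symm (F p))
    continuous_toFun := hH
    map_zero_left := fun v => ?_
    map_one_left := fun v => ?_ }⟩⟩
  · -- at `t = 0`: the pushed dual knot
    rw [hL v (hsolid v), P.collar_of_core v (hsolid v) 0, cFlat, TubeNbhd.fF]
    simp only [hF, Set.Icc.coe_zero, sub_zero, one_mul, smul_zero]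
    rfl
  · -- at `t = 1`: the cocore centre
    show E.trGlueData.inr ((0 : EuclideanSpace ℝ (Fin 2)), κ.symm (F (1, v))) = E.trGlueData.inr (0, 0)
    simp only [hF, Set.Icc.coe_one, sub_self, zero_mul, zero_smul]
    rw [TubeNbhd.univBall_symm_zero]

end SmoothPresentation

end EndDatum

end FriendsTk

/-- **Helper `helper_friendsCarrier_Tk`** (registered helper stub of stub A `stub_friendsCarrier`, line
`mk_friends`, crux `DcrGap`): the relative open trace of the model dotted handlebody `D_k` with a
`2`-handle attached along the model knot `K₀`, with its germ chart along `D_k`, core disc with model collar,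
`Y`-collared end (`Y` = `M_k` surgered along `K₀`, presented by `(jM, ψ, jB)`), and the pushed dual knot
null-homotopic — the `k ≥ 1` analogue of the tree's `Knot.exists_openTrace_of_isIntegralSurgery_holds`
(Kirby 1989, Ch. I §§2, 5; Manolescu–Piccirillo 2023, §3.2). [cite: Kirby1989, Ch. I §5] -/
theorem helper_friendsCarrier_Tk : ∀ (k : ℕ) (K₀ : (sphere (0 : EuclideanSpace ℝ (Fin 2)) 1) → EuclideanSpace ℝ (Fin 4)), IsModelKnot k K₀ → ∀ (Y : Type) [TopologicalSpace Y] [T2Space Y] [SecondCountableTopology Y] [ChartedSpace (EuclideanSpace ℝ (Fin 3)) Y] [IsManifold (𝓡 3) ∞ Y] (jB : solidTorus → Y) (μ₀ : C((sphere (0 : EuclideanSpace ℝ (Fin 2)) 1), Y)) (νK : (sphere (0 : EuclideanSpace ℝ (Fin 2)) 1) × EuclideanSpace ℝ (Fin 2) → EuclideanSpace ℝ (Fin 4)) (jM : EuclideanSpace ℝ (Fin 4) → Y) (W : Set (EuclideanSpace ℝ (Fin 4))) (ψ : Y → EuclideanSpace ℝ (Fin 4)), (Manifold.IsSmoothEmbedding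 (𝓘(ℝ, EuclideanSpace ℝ (Fin 2)).prod (𝓡 1)) (𝓡 3) ∞ jB ∧ IsOpen (range jB) ∧ ContMDiff ((𝓡 1).prod 𝓘(ℝ, EuclideanSpace ℝ (Fin 2))) 𝓘(ℝ, EuclideanSpace ℝ (Fin 4)) ∞ νK ∧ Injective νK ∧ (∀ p, Injective (mfderiv ((𝓡 1).prod 𝓘(ℝ, EuclideanSpace ℝ (Fin 2))) 𝓘(ℝ, EuclideanSpace ℝ (Fin 4)) νK p)) ∧ (∀ p, νK p ∈ modelBoundary k) ∧ (∀ u : (sphere (0 : EuclideanSpace ℝ (Fin 2)) 1), νK (u, 0) = K₀ u) ∧ IsOpen W ∧ (∀ x ∈ modelBoundary k, x ∉ range K₀ → x ∈ W) ∧ ContMDiffOn 𝓘(ℝ, EuclideanSpace ℝ (Fin 4)) (𝓡 3) ∞ jM W ∧ IsOpen (jM '' {x : EuclideanSpace ℝ (Fin 4) | x ∈ modelBoundary k ∧ x ∉ range K₀}) ∧ ContMDiffOn (𝓡 3) 𝓘(ℝ, EuclideanSpace ℝ (Fin 4)) ∞ ψ (jM '' {x : EuclideanSpace ℝ (Fin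 4) | x ∈ modelBoundary k ∧ x ∉ range K₀}) ∧ (∀ x ∈ modelBoundary k, x ∉ range K₀ → ψ (jM x) = x) ∧ jM '' {x : EuclideanSpace ℝ (Fin 4) | x ∈ modelBoundary k ∧ x ∉ range K₀} ∪ range jB = univ ∧ (∀ x ∈ modelBoundary k, x ∉ range K₀ → ∀ b : solidTorus, jM x = jB b ↔ ∃ (u : (sphere (0 : EuclideanSpace ℝ (Fin 2)) 1)) (t : ℝ), t ∈ Ioo (0 : ℝ) 1 ∧ b.1.1 = t • (u : EuclideanSpace ℝ (Fin 2)) ∧ x = νK (u, t • (b.1.2 : EuclideanSpace ℝ (Fin 2))))) → (∀ (v : (sphere (0 : EuclideanSpace ℝ (Fin 2)) 1)) (b : solidTorus), b.1 = (0, v) → μ₀ v = jB b) → ∃ (X : Type) (_ : TopologicalSpace X) (_ : T2Space X) (_ : ChartedSpace (EuclideanSpace ℝ (Fin 4)) X) (_ : IsManifold (𝓡 4) ∞ X) (U : Set (EuclideanSpace ℝ (Fin 4))) (i : EuclideanSpace ℝ (Fin 4) → X) (f₀ : EuclideanSpace ℝ (Fin 2) → X) (g₀ : EuclideanSpace ℝ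 (Fin 2) → EuclideanSpace ℝ (Fin 4)) (c : OpenPartialHomeomorph (Y × ℝ) X), (IsOpen U ∧ modelHandlebody k ⊆ U ∧ ContMDiffOn (𝓡 4) (𝓡 4) ∞ i U ∧ InjOn i U ∧ (∀ x ∈ U, Injective (mfderiv (𝓡 4) (𝓡 4) i x))) ∧ (ContMDiff (𝓡 2) (𝓡 4) ∞ f₀ ∧ InjOn f₀ (closedBall (0 : EuclideanSpace ℝ (Fin 2)) 1) ∧ (∀ x ∈ closedBall (0 : EuclideanSpace ℝ (Fin 2)) 1, Injective (mfderiv (𝓡 2) (𝓡 4) f₀ x)) ∧ (∀ x : EuclideanSpace ℝ (Fin 2), ‖x‖ < 1 → f₀ x ∉ i '' modelHandlebody k) ∧ (∀ t : (sphere (0 : EuclideanSpace ℝ (Fin 2)) 1), f₀ t = i (K₀ t)) ∧ ContDiff ℝ ∞ g₀ ∧ (∃ η : ℝ, 0 < η ∧ (∀ x : EuclideanSpace ℝ (Fin 2), 1 - η < ‖x‖ → ‖x‖ ≤ 1 → g₀ x ∈ U ∧ f₀ x = i (g₀ x))) ∧ (∀ t : (sphere (0 : EuclideanSpace ℝ (Fin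 2)) 1), deriv (fun ρ : ℝ => levelFun k (g₀ (ρ • (t : EuclideanSpace ℝ (Fin 2))))) 1 < 0)) ∧ c.source = univ ∧ ContMDiffOn ((𝓡 3).prod 𝓘(ℝ, ℝ)) (𝓡 4) ∞ c c.source ∧ ContMDiffOn (𝓡 4) ((𝓡 3).prod 𝓘(ℝ, ℝ)) ∞ c.symm c.target ∧ c.target = (i '' modelHandlebody k ∪ f₀ '' closedBall 0 1)ᶜ ∧ (∀ a : ℝ, IsCompact ((i '' modelHandlebody k ∪ f₀ '' closedBall 0 1) ∪ c '' {p | p.2 ≤ a})) ∧ (∀ a : ℝ, IsClosed (c '' {p | a ≤ p.2})) ∧ ∀ L₀ : C((sphere (0 : EuclideanSpace ℝ (Fin 2)) 1), X), (∀ v, L₀ v = c (μ₀ v, 0)) → ∃ x₀ : X, L₀.Homotopic (ContinuousMap.const (sphere (0 : EuclideanSpace ℝ (Fin 2)) 1) x₀) := by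
  intro k K₀ _ Y _ _ _ _ _ jB μ₀ νK jM W ψ ⟨h1, h2, h3, h4, h5, h6, h7, h8, h9, h10, h11, h12, h13, h14, h15⟩ hμ
  let E : FriendsTk.EndDatum k := FriendsTk.EndDatum.endDatumOf h3 h4 h5 h6 h7
  let P : E.SmoothPresentation Y := FriendsTk.EndDatum.smoothPresentationOf h3 h4 h5 h6 h7 h1 h2 h8 h9 h10 h11 h12 h13 h14 h15
  have hνK0 : ∀ u : Metric.sphere (0 : EuclideanSpace ℝ (Fin 2)) 1, E.νK (u, 0) = K₀ u := fun u => by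
    show νK (u, OpenPartialHomeomorph.univBall (0 : EuclideanSpace ℝ (Fin 2)) 2 0) = K₀ u
    rw [OpenPartialHomeomorph.univBall_apply_zero]; exact h7 u
  have hsolid : ∀ v : Metric.sphere (0 : EuclideanSpace ℝ (Fin 2)) 1, ((0 : EuclideanSpace ℝ (Fin 2)), v) ∈ solidTorus := fun v => by
    simp [mem_solidTorus_iff]
  refine ⟨E.Trace, inferInstance, inferInstance, inferInstance, inferInstance, E.hbNbhd, E.incl, E.coreDisc, E.collarGerm, P.collarPH,
    ⟨E.isOpen_hbNbhd, E.modelHandlebody_subset_hbNbhd, E.contMDiffOn_incl, E.injOn_incl, fun x hx => E.injective_mfderiv_incl hx⟩,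
    ⟨E.contMDiff_coreDisc, E.injective_coreDisc.injOn, fun x _ => E.injective_mfderiv_coreDisc x,
      fun x hx => E.coreDisc_not_mem hx, fun t => (E.coreDisc_coe_sphere t).trans (by rw [hνK0]), E.contDiff_collarGerm,
      ⟨1 / 4, by norm_num, fun x hx1 hx2 => E.coreDisc_eq_incl_collarGerm hx1 hx2⟩, E.deriv_levelFun_collarGerm⟩,
    rfl, P.contMDiff_collar.contMDiffOn, P.contMDiffOn_collarInv, rfl, P.isCompact_trCore_union_image_le,
    P.isClosed_image_collar_ge, fun L₀ hL => ?_⟩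
  exact P.homotopic_const_of_core L₀ fun v h => by rw [hL v, hμ v ⟨((0 : EuclideanSpace ℝ (Fin 2)), v), h⟩ rfl]; rfl

end Summit.SmoothPoincare4.SmoothPoincare4.Theorems.DcrGap.MkFriends

end
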